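import Literature.AlgebraicGeometry.Resolution.Kuhlmann2019Lemma41
import Literature.AlgebraicGeometry.Resolution.HenselizedRationalArtinSchreier
import Literature.AlgebraicGeometry.Resolution.NormalDegreePDefectless
import HarnessLib

/-!
# Kuhlmann 2019, §4, (4.3): Artin–Schreier generators of Galois extensions of degree `p` of `K(x)^h` with polynomial right-hand side

Topic: `Literature/AlgebraicGeometry/Resolution` (valued function fields). A PROVED step toward
Prop. 4.8 of F.-V. Kuhlmann, *Elimination of ramification II: Henselian rationality*, Israel J.
Math. 234 (2019) = arXiv:1701.05508 — the equal-characteristic half of the degree-`p` step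
`(hstep)` to which `Kuhlmann2019Prop52Reduction.lean` reduces the named fact
`Kuhlmann2019_Prop52_sepClosed`. §4 (p. 7):

> Throughout this section, we will assume that `(K(x)|K, v)` is an immediate transcendental
> extension. We will investigate the structure of Galois extensions `E` of degree
> `p = char Kv > 0` of `K(x)^h`. If `char K = p > 0`, then […] `E|K(x)^h` is an Artin–Schreier
> extension, that is, it is generated by an element `ϑ ∈ E` which satisfies
> (4.1) `ϑ^p − ϑ = a ∈ K(x)^h` ([24, VI, §6, Theorem 6.4]). […] From this fact it follows that
> `a` can be replaced by any other element in `a + ℘(K(x)^h)` without changing the extension.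
> From Hensel's Lemma it follows that `𝓜_{K(x)^h} ⊆ ℘(K(x)^h)` and therefore, `a` can be
> replaced by any other element in `a + 𝓜_{K(x)^h}` without changing the extension. […]
> Assume that the rank of `(K, v)` is 1 and that `char K = p > 0`. By Lemma 4.1, for every
> `a ∈ K(x)^h` there is `f(x) ∈ K[x]` such that `a − f(x) ∈ 𝓜_{K(x)^h}`. Hence in (4.1), `a`
> can be replaced by `f(x)`, so that we have:
> (4.3) `E = K(x)^h(ϑ)` with `ϑ^p − ϑ = f(x) ∈ K[x]`.

This file PROVES (4.3) in the setting of Prop. 5.2 (`K` separably closed of rank one,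
`(K(x)|K, v)` immediate, `x` transcendental): `exists_artinSchreier_generator_eval`. Ingredients,
all PROVED in the tree: the Artin–Schreier generator of a Galois extension of degree `p` in
characteristic `p` (`Literature.FieldTheory.ArtinSchreier`,
`IntermediateField.exists_generator_pow_sub_self_mem`, [24, VI §6 Thm. 6.4]); Lemma 4.1
(`exists_polynomial_valuation_sub_lt_one_of_isSepClosed`, `Kuhlmann2019Lemma41.lean`);
`𝓜 ⊆ ℘` over a henselian field (`exists_artinSchreierRoot_of_valuation_lt_one`,
`HenselizedRationalArtinSchreier.lean`, from Hensel's Lemma `Kuhlmann2010HenselsLemma_holds` and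
`Kuhlmann2010HenselizationIsHenselian_holds`); `K(x)^h(ϑ − d) = K(x)^h(ϑ)` for `d ∈ K(x)^h`
(`adjoin_simple_sub_algebraMap`).

What remains for Prop. 4.8 after (4.3): the normal form of Lemma 4.2 for `f(x)` modulo
`℘(K(x)^h)`, and Lemma 4.7 (= [23, Thm. 9.1 with Cor. 7.7]: `K(z)^h = K(g(z))^h`).

## Sources

* [K19] F.-V. Kuhlmann, Israel J. Math. 234 (2019) = arXiv:1701.05508: §4, (4.1)–(4.3),
  Lemma 4.1, Prop. 4.8. [Kuhlmann2019]
* [24] S. Lang, *Algebra*, GTM 211 (2002): Ch. VI §6, Thm. 6.4 (Artin–Schreier). [Lang2002]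
* [K10] F.-V. Kuhlmann, Trans. AMS 362 (2010) = arXiv:1003.5678: §4, (4.5)–(4.6).
  [Kuhlmann2010]

## Rendering notes

As in `Kuhlmann2019Prop52Reduction.lean` / `Kuhlmann2019Lemma41.lean`: subfields of one
algebraically closed valued field `(Ω, V)` of characteristic `p`, `K(z) = Subfield.closure
(K ∪ {z})`, `K(z)^h = henselization V K(z)`, Galois extension of degree `p` = `IsGaloisStep p`
(`NormalDegreePDefectless.lean`), `K[z]` = values at `z` of polynomials over `Ω` with
coefficients in `K`, `K(z)^h(ϑ) = Subfield.closure (K(z)^h ∪ {ϑ})`. No definition is introduced.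
-/

noncomputable section

namespace Literature.AlgebraicGeometry.Resolution

universe u

open Polynomial IsLocalRing IntermediateField

variable {Ω : Type u} [Field Ω] [IsAlgClosed Ω] (V : ValuationSubring Ω) (K : Subfield Ω)

/-- **Kuhlmann 2019, §4, (4.3).** Let `K ≤ Ω` be separably closed of rank one, `z`
transcendental over `K` with `(K(z)|K, V)` immediate, `char Ω = p > 0`, and let `E` be a Galois
extension of degree `p` of `K(z)^h = henselization V K(z)` inside `Ω`. Then `E = K(z)^h(ϑ)` for
some `ϑ ∈ E` with `ϑ^p − ϑ = f(z)`, `f` a polynomial over `K`. PROVED: an Artin–Schreier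
generator `ϑ₀` with `ϑ₀^p − ϑ₀ = a ∈ K(z)^h` exists ([24, VI §6 Thm. 6.4]); by Lemma 4.1,
`a = f(z) + m` with `v(m) > 0`; by Hensel's Lemma `m = d^p − d` with `d ∈ K(z)^h`; and
`ϑ = ϑ₀ − d` generates the same extension with `ϑ^p − ϑ = a − m = f(z)`.
[cite: Kuhlmann2019, Section 4, (4.3)] -/
theorem exists_artinSchreier_generator_eval {p : ℕ} [Fact p.Prime] [CharP Ω p] [IsSepClosed K]
    {z : Ω} (hz : Transcendental K z)
    (himm : IsImmediateOver V K (Subfield.closure ((K : Set Ω) ∪ {z}))) (hr : IsRankOne V K)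
    {E : Subfield Ω} (hE : IsGaloisStep p (henselization V (Subfield.closure ((K : Set Ω) ∪ {z}))) E) :
    ∃ ϑ ∈ E, ∃ f : Polynomial Ω, (∀ k, f.coeff k ∈ K) ∧ ϑ ^ p - ϑ = f.eval z ∧
      E = Subfield.closure
        ((henselization V (Subfield.closure ((K : Set Ω) ∪ {z})) : Set Ω) ∪ {ϑ}) := by
  classical
  have hp : p.Prime := Fact.out
  set Kz : Subfield Ω := Subfield.closure ((K : Set Ω) ∪ {z}) with hKzdef
  set L : Subfield Ω := henselization V Kz with hLdef
  have hKKz : K ≤ Kz := fun c hc => Subfield.subset_closure (Or.inl hc)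
  have hzKz : z ∈ Kz := Subfield.subset_closure (Or.inr rfl)
  have hKzL : Kz ≤ L := le_henselization V Kz
  haveI : CharP L p := (algebraMap L Ω).charP Subtype.val_injective p
  -- the Galois step as an intermediate field over `L`
  obtain ⟨hle, hdeg, hgal⟩ := hE
  haveI := hgal
  haveI : FiniteDimensional L (Subfield.extendScalars hle) :=
    Module.finite_of_finrank_pos (by rw [hdeg]; exact hp.pos)
  -- Artin–Schreier generator `ϑ₀`, `ϑ₀^p − ϑ₀ = a ∈ L`
  obtain ⟨ϑ₀, hϑ₀E, ⟨a, ha⟩, hgen⟩ :=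
    Literature.FieldTheory.ArtinSchreier.IntermediateField.exists_generator_pow_sub_self_mem
      (Subfield.extendScalars hle) hdeg
  have hϑ₀E' : ϑ₀ ∈ E := hϑ₀E
  have haL : (a : Ω) ∈ L := a.2
  have ha' : (a : Ω) = ϑ₀ ^ p - ϑ₀ := ha
  -- Lemma 4.1: `a = f(z) + m`, `v(m) < 1`
  obtain ⟨f, hf, hvm⟩ := exists_polynomial_valuation_sub_lt_one_of_isSepClosed V K hz himm hr haL
  have hfzL : f.eval z ∈ L := hKzL (eval_mem_subfield_of_coeff_mem (fun k => hKKz (hf k)) hzKz)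
  have hmL : (a : Ω) - f.eval z ∈ L := sub_mem haL hfzL
  -- Hensel: `m = d^p − d`, `d ∈ L`
  have hLh : IsHenselianField L (V.comap (algebraMap L Ω)) :=
    Kuhlmann2010HenselizationIsHenselian_holds Ω V Kz
  have hH : HenselianLocalRing (V.comap (algebraMap L Ω)) := Kuhlmann2010HenselsLemma_holds _ _ hLh
  obtain ⟨d, hdL, hdeq, -⟩ := exists_artinSchreierRoot_of_valuation_lt_one hH hmL hvm
  -- the new generator `ϑ = ϑ₀ − d`
  refine ⟨ϑ₀ - d, sub_mem hϑ₀E' (hle hdL), f, hf, ?_, ?_⟩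
  · rw [sub_pow_char]
    have h1 : ϑ₀ ^ p - d ^ p - (ϑ₀ - d) = (ϑ₀ ^ p - ϑ₀) - (d ^ p - d) := by ring
    rw [h1, ← ha', hdeq]
    ring
  · -- `L⟮ϑ₀ − d⟯ = L⟮ϑ₀⟯ = E`
    have hadj : L⟮ϑ₀ - d⟯ = Subfield.extendScalars hle := by
      have h := Literature.FieldTheory.ArtinSchreier.adjoin_simple_sub_algebraMap (F := L) (E := Ω)
        ϑ₀ ⟨d, hdL⟩
      rw [← hgen, ← h]
      rfl
    have h2 := congrArg IntermediateField.toSubfield hadj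
    rw [Subfield.extendScalars_toSubfield, adjoin_toSubfield_eq_closure] at h2
    exact h2.symm

end Literature.AlgebraicGeometry.Resolution

end
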